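import Literature.MathematicalPhysics.QuantumFieldTheory.Balaban1983to89.Setup

/-!
# `Balaban1983to89.B8SectAStatements` — B8 Sect. A, the remark (1.10): the Wilson-action form of the regularity
# condition (1.7), on the torus carriers of `Setup` (`GaugeField P i G`, `GaugeGroup.reTr`, `GaugeGroup.dist1`)

statement-level skeleton of published theorems with citation tags; proofs where landed; nothing here is a claim
about the Yang–Mills mass gap

CITATION HEADER (lean-in-tree rule 2026-08-18; mega-formalization `lit-balaban`, reader/typer seat r05 — SKELETON
row `B8.Eq1.10` of `HOME/lit-balaban-r05/ROWS-B8.md`, interface note I-B8-5; the block "(1.7)–(1.10) [14]" is cited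
by B12 p. 261).  T. Bałaban, *Spaces of regular gauge field configurations on a lattice and gauge fixing
conditions*, Commun. Math. Phys. **99** (1985) 75–102 `[Balaban1985RegularSpaces]` ("B8").  PDF held:
`paper:balaban1985-cmp99-regular-spaces-gauge-fixing` (journal page = PDF page + 74); page read: p. 77 [PDF 3]
(text `p0003.txt`, render `1985-cmp99-regular-spaces-gauge-fixing-p003-x2.png`).

THE PRINTED TEXT (p. 77).  «… for a sequence (1.3) and a positive number α₀ we define 𝔄_k({Ω_j}, α₀) as a set of all
gauge field configurations U on T_η satisfying the conditions |U(∂p) − 1| < α₀L^{−2j} for p ∈ Ω_j, j = 0, 1, …, k,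
(1.7) or |U(∂p) − 1| < α₀η²(Lʲη)⁻² for p ∈ Ω_j, (1.8) … We have denoted U(∂p) = (∂U)(p). These conditions may be
written in many equivalent ways, for example (1.7) may be replaced by η⁻⁴[1 − Re tr U(∂p)] < α₀²(Lʲη)⁻⁴, p ∈ Ω_j.
(1.10)  Of course it is enough to assume that (1.7), (1.9) hold for p, b ∈ Bʲ(Λ_j), because if these conditions hold
for some j = l, then they hold for all j < l.»

WHAT IS TYPED HERE (definitions with bodies, in the vocabulary of `Setup`, where the consumer B12 lives; the ℤᵈ/𝔸
carrier form of (1.7)–(1.9) is `B8Ineq132.CondAt`/`InAk`, which records "(1.10) NOT typed (needs Re tr)"):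
* `WilsonSmallOn S η ℓ α₀ U` — (1.10) on ONE plaquette set `S = Ω_j` with level scale `ℓ = Lʲ`:
  «η⁻⁴[1 − Re tr U(∂p)] < α₀²(ℓη)⁻⁴ for p ∈ S»;
* `InAkWilson Ω k η L α₀ U` — (1.10) for the whole sequence, `j = 0, …, k`;
* `InAkOn Ω k L α₀ U` — the plaquette clause (1.7) for the sequence, as the k-level conjunction of the EXISTING
  one-level predicate `Setup.PlaqSmallOn` (the torus-carrier companion of `B8Ineq132.InAk`'s plaquette clause;
  the bond clause (1.9) needs the covariant divergence, typed on the ℤᵈ carriers only, `B8Ineq132.covDiv`);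
* API: unfolding lemmas, monotonicity in `α₀` and in the plaquette sets, and the print's remark "if these conditions
  hold for some j = l, then they hold for all j < l" in its threshold form (`threshold_anti`: the level-`l`
  threshold is the smallest).
* (v1.1, append-only) `MetricClause14` — the second clause of (1.4) «(Lʲη)⁻¹dist(Ω_jᶜ, Ω_{j+1}) > RM₁», stated
  pointwise over a supplied distance function (generic in the site type; the ℤᵈ record `B8ConstraintBonds.DomainSeq`
  carries the nesting/block clauses of (1.3)–(1.4) but not this metric clause — SKELETON row B8.Eq1.3, F6);
  `bondsBetween` — (1.23) «Bʲ(c) = {b ⊂ T : b₋ ∈ Bʲ(c₋), b₊ ∈ Bʲ(c₊)}» over a supplied block map (on the `Setup`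
  carriers, one level: `blockOf`, `PBond.src`, `PBond.tgt` — `bondsBetweenBlocks`), row B8.Eq1.23.
* (v1.2, docstring-only) the private helper `plaqHol_one'` now carries a locator tag (lead LINT PUNCH LIST 22:56Z).
SCOPE / HONESTY.  "Re tr" is the class field `GaugeGroup.reTr` of `Setup` (normalized, `reTr 1 = 1`; the matrix
model is not fixed there — DIVERGENCE F4 of `Setup`), so (1.10) is typed relative to that datum; the print fixes no
normalization either and asserts the equivalence (1.7) ⇔ (1.10) only up to the implicit change of α₀ ("may be
replaced by") — that equivalence is NOT stated here (it needs a `dist1`–`reTr` comparison the abstract class does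
not carry).  Nothing here is new mathematics.
-/

namespace Literature.MathematicalPhysics.QuantumFieldTheory.Balaban1983to89.B8SectAStatements

open Literature.MathematicalPhysics.QuantumFieldTheory.Balaban1983to89

variable {P : Params} {i : ℕ} {G : Type*} [GaugeGroup G]

/-! ## §1 (1.10), the Wilson-action form -/

/-- **(1.10)** p. 77 [PDF 3], verbatim: *"(1.7) may be replaced by η⁻⁴[1 − Re tr U(∂p)] < α₀²(Lʲη)⁻⁴,
p ∈ Ω_j. (1.10)"* — on one plaquette set `S` (= Ω_j) with the level scale `ℓ` (= Lʲ): for every `p ∈ S`,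
`η⁻⁴(1 − Re tr U(∂p)) < α₀²(ℓη)⁻⁴`. [cite: Balaban1985RegularSpaces, (1.10) p.77] -/
def WilsonSmallOn (S : Set (Plaq P i)) (η ℓ α₀ : ℝ) (U : GaugeField P i G) : Prop :=
  ∀ p ∈ S, (η ^ 4)⁻¹ * (1 - reTr (GaugeField.plaqHol U p)) < α₀ ^ 2 * ((ℓ * η) ^ 4)⁻¹

/-- **(1.10) for the sequence of domains** (1.3) `Ω₀ ⊃ Ω₁ ⊃ … ⊃ Ω_k` (given here as plaquette sets `Ω j`,
the convention of p. 77 identifying a domain with its set of plaquettes): the condition (1.10) on `Ω_j` with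
`ℓ = Lʲ` for `j = 0, 1, …, k`. [cite: Balaban1985RegularSpaces, (1.10) p.77] -/
def InAkWilson (Ω : ℕ → Set (Plaq P i)) (k : ℕ) (η : ℝ) (L : ℕ) (α₀ : ℝ) (U : GaugeField P i G) : Prop :=
  ∀ j ≤ k, WilsonSmallOn (Ω j) η ((L : ℝ) ^ j) α₀ U

/-- **(1.7) for the sequence of domains**, plaquette clause, verbatim: *"|U(∂p) − 1| < α₀L^{−2j} for p ∈ Ω_j,
j = 0, 1, …, k, (1.7)"* — the k-level conjunction of `Setup.PlaqSmallOn` (torus carriers, `|·| = dist1`).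
[cite: Balaban1985RegularSpaces, (1.7) p.77] -/
def InAkOn (Ω : ℕ → Set (Plaq P i)) (k : ℕ) (L : ℕ) (α₀ : ℝ) (U : GaugeField P i G) : Prop :=
  ∀ j ≤ k, PlaqSmallOn (Ω j) (α₀ * (((L : ℝ) ^ j) ^ 2)⁻¹) U

/-! ## §2 API -/

/-- Unfolding of (1.10) on one set. [cite: Balaban1985RegularSpaces, (1.10) p.77] -/
theorem wilsonSmallOn_iff (S : Set (Plaq P i)) (η ℓ α₀ : ℝ) (U : GaugeField P i G) :
    WilsonSmallOn S η ℓ α₀ U ↔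
      ∀ p ∈ S, (η ^ 4)⁻¹ * (1 - reTr (GaugeField.plaqHol U p)) < α₀ ^ 2 * ((ℓ * η) ^ 4)⁻¹ :=
  Iff.rfl

/-- Unfolding of (1.7) for the sequence. [cite: Balaban1985RegularSpaces, (1.7) p.77] -/
theorem inAkOn_iff (Ω : ℕ → Set (Plaq P i)) (k L : ℕ) (α₀ : ℝ) (U : GaugeField P i G) :
    InAkOn Ω k L α₀ U ↔
      ∀ j ≤ k, ∀ p ∈ Ω j, dist1 (GaugeField.plaqHol U p) < α₀ * (((L : ℝ) ^ j) ^ 2)⁻¹ :=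
  Iff.rfl

/-- The left side of (1.10) is non-negative: `1 − Re tr U(∂p) ≥ 0` (`reTr ≤ 1` in `Setup.GaugeGroup`), so (1.10)
forces `α₀ ≠ 0` on a non-empty `S`. [cite: Balaban1985RegularSpaces, (1.10) p.77] -/
theorem wilson_lhs_nonneg (η : ℝ) (U : GaugeField P i G) (p : Plaq P i) :
    0 ≤ (η ^ 4)⁻¹ * (1 - reTr (GaugeField.plaqHol U p)) := by
  have h1 : 0 ≤ 1 - reTr (GaugeField.plaqHol U p) := sub_nonneg.2 (GaugeGroup.reTr_le_one _)
  have h2 : 0 ≤ (η ^ 4)⁻¹ := by positivity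
  exact mul_nonneg h2 h1

/-- (1.10) is monotone in `α₀ ≥ 0`. [cite: Balaban1985RegularSpaces, (1.10) p.77] -/
theorem wilsonSmallOn_mono {S : Set (Plaq P i)} {η ℓ α₀ α₀' : ℝ} (h0 : 0 ≤ α₀) (h : α₀ ≤ α₀')
    {U : GaugeField P i G} (hU : WilsonSmallOn S η ℓ α₀ U) : WilsonSmallOn S η ℓ α₀' U := by
  intro p hp
  refine (hU p hp).trans_le ?_
  have hsq : α₀ ^ 2 ≤ α₀' ^ 2 := pow_le_pow_left₀ h0 h 2
  exact mul_le_mul_of_nonneg_right hsq (by positivity)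

/-- (1.10) restricts to smaller plaquette sets (the remark "it is enough to assume … for p ∈ Bʲ(Λ_j)" uses the
converse direction together with `threshold_anti`). [cite: Balaban1985RegularSpaces, (1.10) p.77] -/
theorem wilsonSmallOn_anti_set {S T : Set (Plaq P i)} (hST : S ⊆ T) {η ℓ α₀ : ℝ} {U : GaugeField P i G}
    (hU : WilsonSmallOn T η ℓ α₀ U) : WilsonSmallOn S η ℓ α₀ U :=
  fun p hp => hU p (hST hp)

/-- (1.7) for the sequence is monotone in `α₀`. [cite: Balaban1985RegularSpaces, (1.7) p.77] -/
theorem inAkOn_mono {Ω : ℕ → Set (Plaq P i)} {k L : ℕ} {α₀ α₀' : ℝ} (h : α₀ ≤ α₀') {U : GaugeField P i G}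
    (hU : InAkOn Ω k L α₀ U) : InAkOn Ω k L α₀' U := by
  intro j hj p hp
  exact (hU j hj p hp).trans_le (mul_le_mul_of_nonneg_right h (by positivity))

/-- Fewer levels: (1.7) for `k` implies (1.7) for every `k' ≤ k`. [cite: Balaban1985RegularSpaces, (1.7) p.77] -/
theorem inAkOn_of_le {Ω : ℕ → Set (Plaq P i)} {k k' L : ℕ} (hk : k' ≤ k) {α₀ : ℝ} {U : GaugeField P i G}
    (hU : InAkOn Ω k L α₀ U) : InAkOn Ω k' L α₀ U :=
  fun j hj => hU j (hj.trans hk)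

/-- The thresholds decrease with the level (`1 ≤ L`, `0 ≤ α₀`): `α₀L^{−2l} ≤ α₀L^{−2j}` for `j ≤ l` — the
arithmetic behind p. 77 "if these conditions hold for some j = l, then they hold for all j < l" (a plaquette of
`Ω_l ⊂ Ω_j` satisfying the level-`l` bound satisfies the level-`j` bound). [cite: Balaban1985RegularSpaces, (1.7) p.77] -/
theorem threshold_anti {L : ℕ} (hL : 1 ≤ L) {α₀ : ℝ} (h0 : 0 ≤ α₀) {j l : ℕ} (hjl : j ≤ l) :
    α₀ * (((L : ℝ) ^ l) ^ 2)⁻¹ ≤ α₀ * (((L : ℝ) ^ j) ^ 2)⁻¹ := by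
  refine mul_le_mul_of_nonneg_left ?_ h0
  have hL' : (1 : ℝ) ≤ L := by exact_mod_cast hL
  have hpos : 0 < ((L : ℝ) ^ j) ^ 2 := by positivity
  refine (inv_le_inv₀ (by positivity) hpos).2 ?_
  have : (L : ℝ) ^ j ≤ (L : ℝ) ^ l := pow_le_pow_right₀ hL' hjl
  exact pow_le_pow_left₀ (by positivity) this 2

/-- The remark of p. 77 in predicate form: if a plaquette `p` lies in `Ω_l` and satisfies the level-`l` bound of
(1.7), it satisfies the level-`j` bound for every `j ≤ l`. [cite: Balaban1985RegularSpaces, (1.7) p.77] -/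
theorem plaq_bound_of_deeper {L : ℕ} (hL : 1 ≤ L) {α₀ : ℝ} (h0 : 0 ≤ α₀) {j l : ℕ} (hjl : j ≤ l)
    {U : GaugeField P i G} {p : Plaq P i}
    (hp : dist1 (GaugeField.plaqHol U p) < α₀ * (((L : ℝ) ^ l) ^ 2)⁻¹) :
    dist1 (GaugeField.plaqHol U p) < α₀ * (((L : ℝ) ^ j) ^ 2)⁻¹ :=
  hp.trans_le (threshold_anti hL h0 hjl)

/-- The same for (1.10): `α₀²(Lˡη)⁻⁴ ≤ α₀²(Lʲη)⁻⁴` for `j ≤ l` (`1 ≤ L`, `η ≠ 0` not needed: both sides carry the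
same factor `η⁻⁴ ≥ 0`). [cite: Balaban1985RegularSpaces, (1.10) p.77] -/
theorem wilson_threshold_anti {L : ℕ} (hL : 1 ≤ L) (α₀ η : ℝ) {j l : ℕ} (hjl : j ≤ l) :
    α₀ ^ 2 * ((((L : ℝ) ^ l) * η) ^ 4)⁻¹ ≤ α₀ ^ 2 * ((((L : ℝ) ^ j) * η) ^ 4)⁻¹ := by
  refine mul_le_mul_of_nonneg_left ?_ (sq_nonneg _)
  rw [mul_pow, mul_pow, mul_inv, mul_inv]
  refine mul_le_mul_of_nonneg_right ?_ (by positivity)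
  have hL' : (1 : ℝ) ≤ L := by exact_mod_cast hL
  have hpos : 0 < ((L : ℝ) ^ j) ^ 4 := by positivity
  refine (inv_le_inv₀ (by positivity) hpos).2 ?_
  exact pow_le_pow_left₀ (by positivity) (pow_le_pow_right₀ hL' hjl) 4

/-! ## §3 Non-vacuity: the trivial configuration -/

/-- `U ≡ 1` has trivial plaquette variables (also `T4SmallFieldWindowSandwich.plaqHol_one`; re-proved here to keep
the imports at `Setup`).  Elementary API for the non-vacuity of the space (1.10) (`wilsonSmallOn_one` below).
[cite: Balaban1985RegularSpaces, (1.10) p.77] [folklore] -/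
private theorem plaqHol_one' (p : Plaq P i) : GaugeField.plaqHol (1 : GaugeField P i G) p = 1 := by
  simp [GaugeField.plaqHol, show ∀ b, (1 : GaugeField P i G) b = 1 from fun _ => rfl]

/-- The space (1.10) is non-empty: `U ≡ 1` satisfies (1.10) on any plaquette set as soon as the threshold is
positive (`α₀ ≠ 0`, `ℓη ≠ 0`), since `1 − Re tr 1 = 0`. [cite: Balaban1985RegularSpaces, (1.10) p.77] -/
theorem wilsonSmallOn_one (S : Set (Plaq P i)) {η ℓ α₀ : ℝ} (hη : η ≠ 0) (hℓ : ℓ ≠ 0) (h0 : α₀ ≠ 0) :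
    WilsonSmallOn S η ℓ α₀ (1 : GaugeField P i G) := by
  intro p _
  rw [plaqHol_one', GaugeGroup.reTr_one, sub_self, mul_zero]
  have h1 : 0 < α₀ ^ 2 := by positivity
  have h2 : 0 < ((ℓ * η) ^ 4)⁻¹ := by
    have : ℓ * η ≠ 0 := mul_ne_zero hℓ hη
    positivity
  exact mul_pos h1 h2

/-- The space 𝔄_k of (1.7) is non-empty: `U ≡ 1 ∈ 𝔄_k({Ω_j}, α₀)` for `α₀ > 0`, `1 ≤ L` (`|1 − 1| = 0`).
[cite: Balaban1985RegularSpaces, (1.7) p.77] -/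
theorem inAkOn_one (Ω : ℕ → Set (Plaq P i)) (k : ℕ) {L : ℕ} (hL : 1 ≤ L) {α₀ : ℝ} (h0 : 0 < α₀) :
    InAkOn Ω k L α₀ (1 : GaugeField P i G) := by
  intro j _ p _
  rw [plaqHol_one', GaugeGroup.dist1_one]
  have : (0 : ℝ) < L := by exact_mod_cast hL
  positivity

/-! ## §4 (v1.1) The metric clause of (1.4) and the bond sets (1.23) -/

section MetricClause

variable {X : Type*}

/-- **(1.4), second clause** p. 77 [PDF 3], verbatim: *"Ω_j = Bʲ(Ω_j^{(j)}), Ω_j is a sum of cubes of a size M₁Lʲη,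
(Lʲη)⁻¹dist(Ω_jᶜ, Ω_{j+1}) > RM₁. (1.4)  The number M₁ is a size of big blocks and was fixed in [4]. … We assume that
R is a sufficiently large positive integer (a power of L)"* — the distance clause, stated POINTWISE over a supplied
distance `ρ` on the sites of T_η (on a finite lattice the set distance is attained, so "dist(Ω_jᶜ, Ω_{j+1}) > RM₁Lʲη"
is "every pair is farther than RM₁Lʲη"): for `j < k`, `x ∉ Ω_j`, `y ∈ Ω_{j+1}`: `RM₁ < (Lʲη)⁻¹ρ(x, y)`.  The
nesting and block clauses of (1.3)–(1.4) are the ℤᵈ record `B8ConstraintBonds.DomainSeq`; this clause was not a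
field there. [cite: Balaban1985RegularSpaces, (1.4) p.77] -/
def MetricClause14 (ρ : X → X → ℝ) (Ω : ℕ → Set X) (k : ℕ) (η : ℝ) (L R M₁ : ℕ) : Prop :=
  ∀ j < k, ∀ x ∉ Ω j, ∀ y ∈ Ω (j + 1), (R * M₁ : ℝ) < (((L : ℝ) ^ j) * η)⁻¹ * ρ x y

/-- Unfolding of the metric clause. [cite: Balaban1985RegularSpaces, (1.4) p.77] -/
theorem metricClause14_iff (ρ : X → X → ℝ) (Ω : ℕ → Set X) (k : ℕ) (η : ℝ) (L R M₁ : ℕ) :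
    MetricClause14 ρ Ω k η L R M₁ ↔
      ∀ j < k, ∀ x ∉ Ω j, ∀ y ∈ Ω (j + 1), (R * M₁ : ℝ) < (((L : ℝ) ^ j) * η)⁻¹ * ρ x y :=
  Iff.rfl

/-- The clause is monotone in `R`: a larger separation constant implies a smaller one ("R sufficiently large").
[cite: Balaban1985RegularSpaces, (1.4) p.77] -/
theorem metricClause14_anti {ρ : X → X → ℝ} {Ω : ℕ → Set X} {k : ℕ} {η : ℝ} {L R R' M₁ : ℕ} (hR : R' ≤ R)
    (h : MetricClause14 ρ Ω k η L R M₁) : MetricClause14 ρ Ω k η L R' M₁ := by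
  intro j hj x hx y hy
  refine lt_of_le_of_lt ?_ (h j hj x hx y hy)
  exact_mod_cast Nat.mul_le_mul_right M₁ hR

/-- The admitted degenerate case of p. 77 («we admit the case where some domains Ω_j are equal to T_η»): if
`Ω_j` is the whole lattice the level-`j` clause is vacuous. [cite: Balaban1985RegularSpaces, (1.4) p.77] -/
theorem metricClause14_level_univ {ρ : X → X → ℝ} {Ω : ℕ → Set X} {j : ℕ} (hΩ : Ω j = Set.univ) (η : ℝ)
    (L R M₁ : ℕ) (x y : X) (hx : x ∉ Ω j) : (R * M₁ : ℝ) < (((L : ℝ) ^ j) * η)⁻¹ * ρ x y :=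
  absurd (hΩ ▸ Set.mem_univ x) hx

end MetricClause

section Bonds

variable {B X Y : Type*}

/-- **(1.23)** p. 79 [PDF 5], verbatim: *"Let us introduce a set of bonds. For a bond c ⊂ T^{(j)} we take a set of
bonds connecting the blocks Bʲ(c₋), Bʲ(c₊) and denote it by Bʲ(c), thus Bʲ(c) = {b ⊂ T : b₋ ∈ Bʲ(c₋),
b₊ ∈ Bʲ(c₊)}. (1.23)"* — over a supplied block map `blk` (fine site ↦ the coarse site whose block contains it) and
bond end-points `src`/`tgt` (`b₋`/`b₊`), for the coarse bond with end-points `cm`, `cp`.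
[cite: Balaban1985RegularSpaces, (1.23) p.79] -/
def bondsBetween (blk : X → Y) (src tgt : B → X) (cm cp : Y) : Set B :=
  {b | blk (src b) = cm ∧ blk (tgt b) = cp}

/-- Membership in (1.23), unfolded. [cite: Balaban1985RegularSpaces, (1.23) p.79] -/
theorem mem_bondsBetween (blk : X → Y) (src tgt : B → X) (cm cp : Y) (b : B) :
    b ∈ bondsBetween blk src tgt cm cp ↔ blk (src b) = cm ∧ blk (tgt b) = cp :=
  Iff.rfl

/-- (1.23) on the `Setup` torus carriers, one blocking level (`Bʲ` with j = 1: `Setup.blockOf`), for a coarse bond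
`c : PBond P (i+1)`: the fine bonds `b : PBond P i` with `b₋ ∈ B(c₋)` and `b₊ ∈ B(c₊)`.
[cite: Balaban1985RegularSpaces, (1.23) p.79] -/
def bondsBetweenBlocks {P : Params} {i : ℕ} (c : PBond P (i + 1)) : Set (PBond P i) :=
  bondsBetween (blockOf (P := P) (j := i)) PBond.src PBond.tgt c.src c.tgt

/-- Membership in `bondsBetweenBlocks`, unfolded to `blockOf`. [cite: Balaban1985RegularSpaces, (1.23) p.79] -/
theorem mem_bondsBetweenBlocks {P : Params} {i : ℕ} (c : PBond P (i + 1)) (b : PBond P i) :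
    b ∈ bondsBetweenBlocks c ↔ blockOf b.src = c.src ∧ blockOf b.tgt = c.tgt :=
  Iff.rfl

end Bonds

end Literature.MathematicalPhysics.QuantumFieldTheory.Balaban1983to89.B8SectAStatements
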